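import Literature.NumberTheory.LFunctions.WeilFirstPrimeCertificateDataC
import HarnessLib

/-!
# First-prime Weil positivity, stage C: kernel check of the even scaled moments ν_132, ν_134, ν_136, ν_138, ν_140, ν_142

Part of `weilCert3C.check` (`WeilFirstPrimeCertificateDataC.lean`), evaluated by `decide +kernel` and kept in its own
file for kernel time and memory (each declaration is checked separately). Assembled in
`WeilFirstPrimeCertificateCCheck.lean`. Pure proof file; nothing is asserted.
-/

noncomputable section

namespace Literature.NumberTheory.LFunctions

set_option maxHeartbeats 0 in
/-- **Kernel check of the scaled moment `ν_{132}`** of the stage-C first-prime certificate. [folklore] -/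
theorem checkNuAt132_weilCert3C : weilCert3C.checkNuAt 132 = true := by
  decide +kernel

set_option maxHeartbeats 0 in
/-- **Kernel check of the scaled moment `ν_{134}`** of the stage-C first-prime certificate. [folklore] -/
theorem checkNuAt134_weilCert3C : weilCert3C.checkNuAt 134 = true := by
  decide +kernel

set_option maxHeartbeats 0 in
/-- **Kernel check of the scaled moment `ν_{136}`** of the stage-C first-prime certificate. [folklore] -/
theorem checkNuAt136_weilCert3C : weilCert3C.checkNuAt 136 = true := by
  decide +kernel

set_option maxHeartbeats 0 in
/-- **Kernel check of the scaled moment `ν_{138}`** of the stage-C first-prime certificate. [folklore] -/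
theorem checkNuAt138_weilCert3C : weilCert3C.checkNuAt 138 = true := by
  decide +kernel

set_option maxHeartbeats 0 in
/-- **Kernel check of the scaled moment `ν_{140}`** of the stage-C first-prime certificate. [folklore] -/
theorem checkNuAt140_weilCert3C : weilCert3C.checkNuAt 140 = true := by
  decide +kernel

set_option maxHeartbeats 0 in
/-- **Kernel check of the scaled moment `ν_{142}`** of the stage-C first-prime certificate. [folklore] -/
theorem checkNuAt142_weilCert3C : weilCert3C.checkNuAt 142 = true := by
  decide +kernel

end Literature.NumberTheory.LFunctions
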